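import Literature.NumberTheory.EllipticCurves.KellerYin2024.PotentiallyGoodOrdinaryIwasawaTheory
import Literature.NumberTheory.EllipticCurves.CastellaHsieh2018.BranchBDPLFunctionExistence
import Literature.NumberTheory.GaloisRepresentations.GlobalArtinMapNormProofs
import Literature.NumberTheory.GaloisRepresentations.HeckeCharacterProofs
import Mathlib.NumberTheory.LegendreSymbol.QuadraticChar.Basic
import Mathlib.NumberTheory.LegendreSymbol.Basic
import HarnessLib

/-!
# Keller–Yin (arXiv:2410.23241) Thm. 3.5.1 READ IN BRANCH CURRENCY: the genus character `χ_ε`,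
# the equality `Char_Λ(𝔛)Λ^ur = (𝓛_ε)` and "`μ(𝓛_ε) = 0`" over Castella–Hsieh branch frames
# `IsBranchBDPLFunction … f̃ χ_ε …` — PREPRINT CLAIMS (`_OPEN`) — and the proved slack bookkeeping

T. Keller, M. Yin, *`p`-converse theorems for elliptic curves of potentially good ordinary
reduction at Eisenstein primes*, arXiv:2410.23241 **v1** (2024-10-30; store text
`paper:arxiv-2410.23241`, 22 chunks; locators `[corpus:paper-arxiv-2410.23241 pNNNN:Lnn]` are
chunk:line), UNREFEREED PREPRINT. Sibling of `PotentiallyGoodOrdinaryIwasawaTheory.lean` (cell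
`bsd-littype`, seat 06), which typed Thm. 3.5.1 in GREENBERG FORM as
`thm351_imc_isTorsion_mu_zero_charIdeal_eq_OPEN`: clauses (i) `𝔛` is `Λ`-torsion, (ii) `μ(𝔛) = 0`
VERBATIM, and (iii) the equality `Char_Λ(𝔛)Λ^ur = (𝓛_ε)` under a TRANSPORT CLAUSE (flag KYb-frame:
`𝓛_ε` read on Castella-shape frames `IsBDPLFunction ι' v κ γ f …` of the newform `f` of the ADDITIVE
curve `E`, via the printed relation "`𝓛_p(f̃, χ_ε(·)) = 𝓛_p(f, ·)`"). This file re-types clause (iii)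
(and the clause "`μ(𝓛_ε) = 0`") over the printed OBJECT itself: Castella–Hsieh's measure for the
good-ordinary member `f̃` of the Heegner pair, restricted to the `χ_ε`-branch — the tree's
`IsBranchBDPLFunction ι' v κ γ f̃ χ_ε e Ω_K Ω_p L` (`BDPBranchPAdicLFunction.lean`, definition item
`defn-BranchBDPLFunction`), whose EXISTENCE at conductor `p` is the published fact
`castellaHsieh2018_exists_isBranchBDPLFunction` (`CastellaHsieh2018/BranchBDPLFunctionExistence.lean`,
Math. Ann. 370 (2018) Def. 3.7 + Prop. 3.8). WHY (route `SchneiderFreeAdditiveX3`, crux r3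
`GordTwoBranchIMC` = item stmt-BirchSwinnertonDyer-19177, memo `door-c3-g8-branch-currency.md`): a
Castella-shape frame for the additive newform `f` is neither printed nor derivable in the tree from
`𝓛_ε` (the rewrite needs local–global compatibility of the `p`-adic avatar AT `v`, which
`IsPAdicAvatarOf` does not record), so the transport clause cannot be fed; the branch frame can (by the
Castella–Hsieh fact), and reading (iii) on it is the VERBATIM statement. Cell `bsd-schneider-ideate`,
seat `bsd-schneider-door-c3` (prover, gen 9; spec kernel-checked by gen 8, evidence n=33/35 on the item).
Every Keller–Yin statement below is `[claim: KellerYin2024PotOrd, status: under-review]`, suffix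
`_OPEN`, no `_holds`; NEVER cite them as theorems.

## Citation header (verbatim) and transcription

* §3.1 Prop. 3.1.3 and its proof [p0014:L20, L31–L33]: "Let `f = f̃ ⊗ ε` be a weight `2` form
  associated to an elliptic curve of potentially good ordinary reduction at `p`. Then there is a
  Heegner pair `(f̃, χ_ε)` such that `V(f̃ ⊗ ε)|_{G_K}` agrees with `V(f̃)|_{G_K} ⊗ χ_ε^{Gal}` …
  We claim that `χ_ε := ε⁻¹ ∘ Nm_{K/ℚ}` is the desired Hecke character … `χ_ε|_{𝔸_ℚ^×} = … = ε^{-2}`."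
  In Case (I) for an elliptic curve (`e = 2`: sibling module docstring, "`f̃ = f_{E^{(p*)}}`,
  `ε = (·/p)`, cond `ε = p`") `ε = ε⁻¹` is the quadratic character mod `p`, so
  → `genusHeckeCharacter K p := (ψ_ε) ∘ N_{K/ℚ}` with `ψ_ε = HeckeCharacter.ofDirichlet ε`
  (`= Disegni2017.baseChangeDirichlet K ε` definitionally), `ε = quadraticChar (ZMod p)` pushed to `ℂ`.
  PROVED: `χ_ε² = 1` (`genusHeckeCharacter_sq`) and `χ_ε` unramified off `p`
  (`genusHeckeCharacter_isUnramifiedAt`) — two of the three hypotheses of the Castella–Hsieh fact; the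
  third (conductor exponent exactly `1` above `p`) is local class field theory for `ψ_ε`, not here.
* §3.1 [p0014:L1]: "an elliptic curve `E` with corresponding weight `2` form `f` that has potentially
  ordinary reduction at `p` is always associated with a pair `(f̃, ε)` such that `f = f̃ ⊗ ε` and `f̃`
  is ordinary"; §3.1 [p0015:L10]: "From now on, we assume `p ∤ N′`." → the partner is presented
  CURVE-FREE by a newform `f′ ∈ S₂(Γ₀(N′))` (`IsNewform0 f′`, trivial nebentypus: `ε² = 1`) with
  `¬ p ∣ N′` and the twist relation `a_ℓ(f) = (ℓ/p)·a_ℓ(f′)` at all but finitely many primes `ℓ`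
  (`legendreSym p ℓ = (ℓ/p) = (p*/ℓ)`; strong multiplicity one pins `f′ = f̃`). On the door this is
  `frobeniusTrace_quadraticTwist` at the good primes `ℓ ∤ 2pN` for `W ≅ W′ ⊗ (p*/·)`.
* §3.4 [p0019:L35]: "On the analytic side, there is a BDP `p`-adic `L`-function
  `𝓛_ε := 𝓛_p(f̃)(χ_ε) := χ_ε(𝓛_p(f̃))` corresponding to a Heegner pair `(f̃, χ_ε)`."
  → a BRANCH FRAME `IsBranchBDPLFunction ι' v κ γ f′ (genusHeckeCharacter K p) e Ω_K Ω_p L`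
  (Castella–Hsieh Def. 3.5 / Prop. 3.6 = journal 3.7 / 3.8, multiplier `e_𝔭 = ε(½, χ_{ε,𝔭})^{-2}` at
  `p ∣ c`; the branch constant `e ≠ 0` and the periods are parameters of the frame, exactly as in the
  published existence fact). FRAME-UNIVERSALITY IS FAITHFUL: two branch frames with the same
  parameters coincide (Weierstrass preparation: infinitely many interpolation points in the open
  disc), and a frame with other parameters `(e′, Ω_K′, Ω_p′)` is `A·(1+T)^s·𝓛_ε` with `A ∈ R₀[1/p]` a
  constant and `s ∈ ℤ_p` (the ratio of prescribed values is `ι′⁻¹(e′/e)·C^{4n}`, interpolable only by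
  a unit `(1+T)^s`), i.e. lies in `p^ℤ · R₀⟦T⟧^× · 𝓛_ε`; the statements below are invariant under
  `L ↦ p^c·u·L` (slack `c`, `FirstUnitCoeffAt`), hence implied by print for every frame.
* **Theorem 3.5.1** [p0020:L23–L34]: "Assume we are in Case (I) of (twists), i.e., `p ∤ N′`. Assume
  that `p = v v̄` splits in `K`. Assume that `H⁰(K, ρ̄_{f̃} ⊗ ε) = 0`. Then `μ(𝔛) = μ(𝓛_ε) = 0` and
  `λ(𝔛) = λ(𝓛_ε)`. Consequently, `Char_Λ(𝔛)Λ^ur = (𝓛_ε)` holds in `Λ^ur`".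
  → `thm351_charIdeal_eq_branch_OPEN` (clause (iii) + "`λ(𝓛_ε) = λ(𝔛)`, `μ(𝓛_ε) = 0`" with slack, on
  branch frames; binders of the sibling's `thm351_…` VERBATIM — `PotOrdSetting ι' W K v v̄ κ N`,
  `IsNewformOf W f`, `𝔛 = AcSelmer.XAc (W.baseChange K) p κ v̄ ∅ γ`, structure map `j` — plus the
  partner `f′` and `[IsGalois ℚ K]` for the norm) and `thm351_mu_zero_branch_OPEN` ("`μ(𝓛_ε) = 0`" for
  frames in Castella–Hsieh's own normalisation `Ω_p ∈ R₀^×`, `e = ±1`: for the quadratic `χ_{ε,𝔭}`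
  Tate's local constant satisfies `ε(½, χ_𝔭)² = χ_𝔭(−1)`, so `e = ε(½, χ_𝔭)^{-2} ∈ {±1}` — restricting
  to `e = ±1` only WEAKENS the claim; frames off that normalisation differ by the constant
  `ι′⁻¹(e′/e)` and may have `μ > 0`).
* PROVED bookkeeping (§3): `charIdeal_map_eq_span_of_branch_OPEN_of_not_dvd` (slack `c = 0` when
  `p ∤ L`); `isBranchBDPLFunction_of_eq_C_mul` (dividing a frame by `p^c` gives a frame with branch
  constant `e/p^c`); `exists_frame_firstUnitCoeff_charIdeal_eq_of_branch_OPEN` (KY′ (iii) turns ANY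
  branch frame into a `μ = 0` frame `L₀` with the same periods and `Char_Λ(𝔛)·R₀⟦T⟧ = (L₀)` — so a
  consumer needs NO separate `μ`-statement and NO Tate constant); and
  `exists_frame_charIdeal_eq_of_castellaHsieh_of_branch_OPEN` (with the Castella–Hsieh existence fact:
  under the Keller–Yin hypotheses and the three branch-character hypotheses, a `μ = 0` branch frame at
  `v` with the equality EXISTS — the door's H1 ∧ H3 at the frame, by name, modulo PUB ∧ PRE).

## What this file is NOT
Not a proof of anything printed by Keller–Yin; not the Castella–Hsieh value formula (Lemma 5.4 /
Thm. 5.7, cite item `wi-73260`); not the conductor-exponent computation for `χ_ε` above `p`; not a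
claim at `e ∈ {3,4,6}` (`p ∣ N′`, outside Prop. 3.1.2) nor for the potentially multiplicative cell.

## References
[KellerYin2024PotOrd] arXiv:2410.23241v1 §3.1 Prop. 3.1.3, §3.4, Thm. 3.5.1 (locators above);
[CastellaHsieh2018] Math. Ann. 370 (2018) §3.3, Def. 3.7, Prop. 3.8 (= arXiv v1 Def. 3.5, Prop. 3.6);
[Gross2004] MSRI Publ. 49, §3 p. 40 (characters `θ ∘ N_{K/ℚ}`, genus theory);
[CastellaGrossiLeeSkinner2022] Thm. 4.2.2 (published `p ∤ N` twin; shape); [Washington1997] §7.1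
(Weierstrass preparation, `μ`/`λ` as first unit coefficient); [TateNTB1979] (3.4.7) (`ε(½,χ)ε(½,χ⁻¹)
= χ(−1)`).
-/

noncomputable section

open scoped Classical NumberField

open PowerSeries WeierstrassCurve NumberField IsDedekindDomain Field Rat.HeightOneSpectrum
  Literature.NumberTheory.EllipticCurves Literature.NumberTheory.EllipticCurves.ModularForms
  Literature.NumberTheory.QuadraticFields Literature.NumberTheory.EllipticCurves.Rank1Residual
  Literature.NumberTheory.EllipticCurves.Castella2018
  Literature.NumberTheory.GaloisRepresentations

namespace Literature.NumberTheory.EllipticCurves.KellerYin2024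

/-! ### §0 The genus character `χ_ε = ε ∘ N_{K/ℚ}` of the Heegner pair -/

section Genus

variable (K : Type) [Field K] [NumberField K] [IsGalois ℚ K] (p : ℕ) [Fact p.Prime]

/-- **The genus character `χ_ε = ε ∘ N_{K/ℚ}` of `K` attached to the odd prime `p`** — Keller–Yin's
branch character of the Heegner pair `(f̃, χ_ε)` of an elliptic curve with `f_E = f̃ ⊗ ε` (Prop.
3.1.3 and its proof, arXiv:2410.23241 [p0014:L20, L31]: "`χ_ε := ε⁻¹ ∘ Nm_{K/ℚ}`"; in Case (I) for an
elliptic curve `ε = ε⁻¹ = (·/p)`, the quadratic Dirichlet character of conductor `p` cutting out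
`ℚ(√p*)`): the base change along the norm (`HeckeCharacter.compRelNorm`, Tate / Cassels–Fröhlich
VII §4.3) of the finite-order Hecke character `ψ_ε = HeckeCharacter.ofDirichlet ε` of `ℚ` — the
tree's `θ ∘ N_{K/ℚ}` of Gross 2004 §3 (`RankinSelbergBaseChangeDirichlet.lean`; definitionally
`Disegni2017.baseChangeDirichlet K ε`) at `θ = ε = quadraticChar (ZMod p)` pushed to `ℂ`. A quadratic
Hecke character of `K` (`genusHeckeCharacter_sq`), unramified off `p`
(`genusHeckeCharacter_isUnramifiedAt`), trivial on norms from `𝔸_ℚ^×` up to `ε² = 1`; for `p ∤ d_K`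
it is the genus character cutting out `K(√p*) ⊂ K[p]`. A definition.
[cite: Gross2004, §3 p. 40 (Hecke characters θ ∘ N_{K/ℚ} of a quadratic field; genus characters)] -/
def genusHeckeCharacter : HeckeCharacter K :=
  (HeckeCharacter.ofDirichlet ((quadraticChar (ZMod p)).ringHomComp (Int.castRingHom ℂ))).compRelNorm K

/-- Unfolding `genusHeckeCharacter`: `χ_ε = ψ_ε ∘ N_{K/ℚ}`. [cite: Gross2004, §3 p. 40 (Hecke characters θ ∘ N_{K/ℚ}; unfolding)] -/
theorem genusHeckeCharacter_def :
    genusHeckeCharacter K p =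
      (HeckeCharacter.ofDirichlet
        ((quadraticChar (ZMod p)).ringHomComp (Int.castRingHom ℂ))).compRelNorm K :=
  rfl

/-- **`χ_ε² = 1`**: the genus character is quadratic (`ε² = 1` on `(ℤ/p)ˣ`, `ψ_ε(x) = ε(u(x))⁻¹`,
and `(ψ ∘ N)² = ψ² ∘ N`). First of the three branch-character hypotheses of
`castellaHsieh2018_exists_isBranchBDPLFunction`.
[cite: Gross2004, §2 p. 40 (rational ring class / genus characters are quadratic)] -/
theorem genusHeckeCharacter_sq : genusHeckeCharacter K p ^ 2 = 1 := by
  refine HeckeCharacter.ext fun y ↦ ?_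
  rw [HeckeCharacter.pow_apply, HeckeCharacter.one_apply, genusHeckeCharacter,
    HeckeCharacter.compRelNorm_apply, HeckeCharacter.ofDirichlet_apply, inv_pow, ← map_pow,
    inv_eq_one]
  ext
  rw [MulChar.coe_toUnitHom, Units.val_pow_eq_pow_val, map_pow, MulChar.ringHomComp_apply,
    ← map_pow, quadraticChar_sq_one (Units.ne_zero _), map_one, Units.val_one]

/-- **`χ_ε` is unramified at every finite place `w ∤ p`** (`ψ_ε` is unramified at the rational primes
`ℓ ≠ p`, and `ψ ∘ N_{K/ℚ}` is unramified above the unramified places of `ψ`). Second of the three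
branch-character hypotheses of `castellaHsieh2018_exists_isBranchBDPLFunction`.
[cite: NeukirchANT1999, Ch. VII Prop. (6.9) (ψ_χ is unramified outside m)]
[cite: CasselsFrohlichANT1967, Ch. VII Prop. 4.3 (ψ ∘ N_{K′/K} is a Hecke character; unramified above unramified places)] -/
theorem genusHeckeCharacter_isUnramifiedAt {w : HeightOneSpectrum (𝓞 K)}
    (hw : ((p : ℕ) : 𝓞 K) ∉ w.asIdeal) : (genusHeckeCharacter K p).IsUnramifiedAt w := by
  refine HeckeCharacter.compRelNorm_isUnramifiedAt (E := K) _
    (HeckeCharacter.isUnramifiedAt_ofDirichlet _ fun hdvd ↦ hw ?_)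
  have hgen : natGenerator (w.under (𝓞 ℚ)) = p :=
    (Nat.prime_dvd_prime_iff_eq (prime_natGenerator _) (Fact.out : p.Prime)).mp hdvd
  have h1 : ((p : ℕ) : 𝓞 ℚ) ∈ (w.under (𝓞 ℚ)).asIdeal := by
    rw [Rat.natCast_mem_asIdeal_iff, hgen]
  rw [HeightOneSpectrum.under_asIdeal, Ideal.under_def, Ideal.mem_comap, map_natCast] at h1
  exact h1

end Genus

/-! ### §1 Thm. 3.5.1 (iii) in branch currency: `Char_Λ(𝔛)Λ^ur = (𝓛_ε)` on the `χ_ε`-branch frames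
of the good-ordinary member `f̃` — OPEN fact -/

/-- **OPEN HYPOTHESIS — UNREFEREED PREPRINT (Keller–Yin, arXiv:2410.23241v1), Theorem 3.5.1, the
equality "`λ(𝔛) = λ(𝓛_ε)`, `μ(𝓛_ε) = 0`, consequently `Char_Λ(𝔛)Λ^ur = (𝓛_ε)` holds in `Λ^ur`"
[p0020:L23–L34], with `𝓛_ε` READ IN BRANCH CURRENCY.** Verbatim hypotheses as in the sibling
`thm351_imc_isTorsion_mu_zero_charIdeal_eq_OPEN` (whose clauses (i) `𝔛` is `Λ`-torsion and (ii)
`μ(𝔛) = 0` are NOT repeated here): the standing data `PotOrdSetting ι' W K v v̄ κ N` of §3 for the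
Heegner pair of the elliptic curve `E = W/ℚ` (Case (I) `p ∤ N′`, `p > 2`, `E[p]` reducible with the
lattice normalised, `E(K)[p] = 0`, Assumption 2.0.3, `p = v v̄` split with `v` induced by `ι'`, `κ`
anticyclotomic), `f` the newform of `W` (`IsNewformOf W f`), `𝔛 = AcSelmer.XAc (W.baseChange K) p κ v̄
∅ γ`. ADDED: the good-ordinary member of the pair presented by its newform — `f′ ∈ S₂(Γ₀(N′))` with
`IsNewform0 f′`, "`p ∤ N′`" [p0015:L10], and "`f = f̃ ⊗ ε`" [p0014:L1] as the cofinite twist relation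
`a_ℓ(f) = (ℓ/p)·a_ℓ(f′)` (`legendreSym p ℓ`; strong multiplicity one pins `f′ = f̃`). CONCLUSION: for
EVERY branch frame `(e ≠ 0, Ω_K ≠ 0, Ω_p ≠ 0, L)` with `IsBranchBDPLFunction ι' v κ γ f′ χ_ε e Ω_K Ω_p L`
(`χ_ε = genusHeckeCharacter K p`; "`𝓛_ε := 𝓛_p(f̃)(χ_ε)`" [p0019:L35], Castella–Hsieh's measure for
`f̃` on the `χ_ε`-branch, multiplier `ε(½, χ_{ε,𝔭})^{-2}`) and THE structure map `j : ℤ_p → R₀`: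
`L = p^c · L₀` with `μ(L₀) = 0`, `λ(L₀) = λ(𝔛)` (`FirstUnitCoeffAt L₀ (lambdaInvariant p 𝔛)`) and
`Char_Λ(𝔛)·R₀⟦T⟧ = (L₀)` — the printed "`μ(𝓛_ε) = 0`, `λ(𝓛_ε) = λ(𝔛)`, `Char_Λ(𝔛)Λ^ur = (𝓛_ε)`"
up to the slack `p^c·u` (module docstring: every frame lies in `p^ℤ·R₀⟦T⟧^×·𝓛_ε`, so this follows
from print for every frame and is vacuous if none exists; existence is the published fact
`castellaHsieh2018_exists_isBranchBDPLFunction`; `c = 0` iff the frame has `μ = 0`,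
`charIdeal_map_eq_span_of_branch_OPEN_of_not_dvd`; a `μ = 0` frame always exists given one frame,
`exists_frame_firstUnitCoeff_charIdeal_eq_of_branch_OPEN`). More faithful than the sibling's clause
(iii) (no transport "`𝓛_p(f̃, χ_ε ·) = 𝓛_p(f, ·)`" needed). SCOPE: `e ≤ 2` (sibling Q-B1). Printed
proof: Thms. 3.3.6 + 3.4.4, then §3.5 (Kriz's congruences, Katz `𝓛_{φε}`, Rubin 1991 + CW78) "as in
[KY24]". NEVER cite this `Prop` as a theorem; conditional on two preprint layers.
[claim: KellerYin2024PotOrd, status: under-review]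
[cite: CastellaHsieh2018, Def. 3.7 and Prop. 3.8 (the object 𝓛_𝔭(f̃) whose χ_ε-branch is 𝓛_ε; = arXiv v1 Def. 3.5 / Prop. 3.6)]
[cite: CastellaGrossiLeeSkinner2022, Thm. 4.2.2 (the published non-anomalous p ∤ N twin; shape)] -/
def thm351_charIdeal_eq_branch_OPEN : Prop :=
  ∀ {p : ℕ} [Fact p.Prime] (ι' : PadicAlgCl p ≃+* ℂ) (W : WeierstrassCurve ℚ) [W.IsElliptic]
    [W.IsGloballyMinimal] (K : Type) [Field K] [NumberField K] [IsGalois ℚ K]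
    (v vbar : HeightOneSpectrum (𝓞 K)) (κ : ZpExtension K p) (γ : absoluteGaloisGroup K)
    [Fact (κ.IsTopGenerator γ)] {N : ℕ} [NeZero N] {f : CuspForm (CongruenceSubgroup.Gamma0 N) 2}
    (_ : IsNewformOf W f), PotOrdSetting ι' W K v vbar κ N →
    ∀ {N' : ℕ} [NeZero N'] {f' : CuspForm (CongruenceSubgroup.Gamma0 N') 2}, IsNewform0 f' →
      ¬ p ∣ N' →
      (∃ S : Finset ℕ, ∀ ℓ : ℕ, ℓ.Prime → ℓ ∉ S →
        cuspCoeff f ℓ = ((legendreSym p ℓ : ℤ) : ℂ) * cuspCoeff f' ℓ) →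
    ∀ (e : ℂ) (ΩK : ℂ) (Ωp : ℂ_[p]) (L : UnrSeries p), e ≠ 0 → ΩK ≠ 0 → Ωp ≠ 0 →
      IsBranchBDPLFunction ι' v κ γ f' (genusHeckeCharacter K p) e ΩK Ωp L →
      ∀ (j : ℤ_[p] →+* unrIntegers p),
        (∀ x : ℤ_[p], ((j x : unrIntegers p) : ℂ_[p]) = algebraMap ℚ_[p] ℂ_[p] (x : ℚ_[p])) →
        ∃ (c : ℕ) (L₀ : UnrSeries p), L = C ((p : unrIntegers p) ^ c) * L₀ ∧
          FirstUnitCoeffAt L₀ (lambdaInvariant p (AcSelmer.XAc (W.baseChange K) p κ vbar ∅ γ)) ∧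
          (AcSelmer.XAc.charIdeal (W.baseChange K) p κ vbar ∅ γ).map (PowerSeries.map j) =
            Ideal.span {L₀}

/-! ### §2 Thm. 3.5.1, the clause "`μ(𝓛_ε) = 0`", in Castella–Hsieh's normalisation — OPEN fact -/

/-- **OPEN HYPOTHESIS — UNREFEREED PREPRINT (Keller–Yin, arXiv:2410.23241v1), Theorem 3.5.1, the
clause "`μ(𝓛_ε) = 0`" [p0020:L27], in branch currency and in Castella–Hsieh's own normalisation.**
Same binders as `thm351_charIdeal_eq_branch_OPEN`; CONCLUSION: for every branch frame of `(f′, χ_ε)`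
at `v` with UNIT `p`-adic period `Ω_p ∈ R₀^×` (Castella–Hsieh Prop. 3.6: `Ω_p ∈ 𝒲^×`) and branch
constant `e = ±1` (= `ε(½, χ_{ε,𝔭})^{-2}`, which for the quadratic `χ_{ε,𝔭}` equals `χ_{ε,𝔭}(−1) ∈
{±1}` by Tate's `ε(½,χ)ε(½,χ⁻¹) = χ(−1)`; restricting to `e = ±1` only WEAKENS the claim — frames with
other constants differ from `𝓛_ε` by `ι′⁻¹(e′/e)·(1+T)^s` and may have positive `μ`): `p ∤ L` in
`R₀⟦T⟧`, i.e. the slack of `thm351_charIdeal_eq_branch_OPEN` is `c = 0` at Castella–Hsieh's frame.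
NOT needed by the route's consumers (they extract a `μ = 0` frame from ANY frame by
`exists_frame_firstUnitCoeff_charIdeal_eq_of_branch_OPEN`); recorded because it is the printed
sentence. NEVER cite this `Prop` as a theorem. [claim: KellerYin2024PotOrd, status: under-review]
[cite: CastellaHsieh2018, Prop. 3.8 (Ω_p ∈ 𝒲^×, e_𝔭 = ε(½,χ_𝔭)^{-2}; = arXiv v1 Prop. 3.6)] -/
def thm351_mu_zero_branch_OPEN : Prop :=
  ∀ {p : ℕ} [Fact p.Prime] (ι' : PadicAlgCl p ≃+* ℂ) (W : WeierstrassCurve ℚ) [W.IsElliptic]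
    [W.IsGloballyMinimal] (K : Type) [Field K] [NumberField K] [IsGalois ℚ K]
    (v vbar : HeightOneSpectrum (𝓞 K)) (κ : ZpExtension K p) (γ : absoluteGaloisGroup K)
    [Fact (κ.IsTopGenerator γ)] {N : ℕ} [NeZero N] {f : CuspForm (CongruenceSubgroup.Gamma0 N) 2}
    (_ : IsNewformOf W f), PotOrdSetting ι' W K v vbar κ N →
    ∀ {N' : ℕ} [NeZero N'] {f' : CuspForm (CongruenceSubgroup.Gamma0 N') 2}, IsNewform0 f' →
      ¬ p ∣ N' →
      (∃ S : Finset ℕ, ∀ ℓ : ℕ, ℓ.Prime → ℓ ∉ S →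
        cuspCoeff f ℓ = ((legendreSym p ℓ : ℤ) : ℂ) * cuspCoeff f' ℓ) →
    ∀ (e : ℂ) (ΩK : ℂ) (Ωp : (unrIntegers p)ˣ) (L : UnrSeries p), (e = 1 ∨ e = -1) → ΩK ≠ 0 →
      IsBranchBDPLFunction ι' v κ γ f' (genusHeckeCharacter K p) e ΩK
        ((Ωp : unrIntegers p) : ℂ_[p]) L →
      ¬ C (p : unrIntegers p) ∣ L

/-! ### §3 Proved bookkeeping: slack `c = 0`, dividing a frame by `p^c`, a `μ = 0` frame from any
frame, and the package with the Castella–Hsieh existence fact -/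

/-- **The door direction from Thm. 3.5.1 (branch currency) when the frame has `μ = 0`**: if `p ∤ L`
in `R₀⟦T⟧` then the slack is `c = 0`, `L = L₀`, and `Char_Λ(𝔛)·R₀⟦T⟧ = (L)` (pattern of the
sibling's `charIdeal_map_eq_span_of_thm351_OPEN_of_not_dvd`). CONDITIONAL on the OPEN claim;
bookkeeping, nothing asserted. [claim: KellerYin2024PotOrd, status: under-review] -/
theorem charIdeal_map_eq_span_of_branch_OPEN_of_not_dvd (h : thm351_charIdeal_eq_branch_OPEN)
    {p : ℕ} [Fact p.Prime] (ι' : PadicAlgCl p ≃+* ℂ) (W : WeierstrassCurve ℚ) [W.IsElliptic]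
    [W.IsGloballyMinimal] (K : Type) [Field K] [NumberField K] [IsGalois ℚ K]
    (v vbar : HeightOneSpectrum (𝓞 K)) (κ : ZpExtension K p) (γ : absoluteGaloisGroup K)
    [Fact (κ.IsTopGenerator γ)] {N : ℕ} [NeZero N] {f : CuspForm (CongruenceSubgroup.Gamma0 N) 2}
    (hf : IsNewformOf W f) (hS : PotOrdSetting ι' W K v vbar κ N)
    {N' : ℕ} [NeZero N'] {f' : CuspForm (CongruenceSubgroup.Gamma0 N') 2} (hf' : IsNewform0 f')
    (hpN' : ¬ p ∣ N')
    (htw : ∃ S : Finset ℕ, ∀ ℓ : ℕ, ℓ.Prime → ℓ ∉ S →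
      cuspCoeff f ℓ = ((legendreSym p ℓ : ℤ) : ℂ) * cuspCoeff f' ℓ)
    {e : ℂ} {ΩK : ℂ} {Ωp : ℂ_[p]} {L : UnrSeries p} (he : e ≠ 0) (hΩK : ΩK ≠ 0) (hΩp : Ωp ≠ 0)
    (hL : IsBranchBDPLFunction ι' v κ γ f' (genusHeckeCharacter K p) e ΩK Ωp L)
    (hμ : ¬ C (p : unrIntegers p) ∣ L) (j : ℤ_[p] →+* unrIntegers p)
    (hj : ∀ x : ℤ_[p], ((j x : unrIntegers p) : ℂ_[p]) = algebraMap ℚ_[p] ℂ_[p] (x : ℚ_[p])) :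
    (AcSelmer.XAc.charIdeal (W.baseChange K) p κ vbar ∅ γ).map (PowerSeries.map j) =
      Ideal.span {L} := by
  obtain ⟨c, L₀, hLL₀, -, hspan⟩ :=
    h ι' W K v vbar κ γ hf hS hf' hpN' htw e ΩK Ωp L he hΩK hΩp hL j hj
  rcases Nat.eq_zero_or_pos c with rfl | hc
  · rw [hspan, hLL₀, pow_zero, map_one, one_mul]
  · exfalso
    refine hμ ⟨C ((p : unrIntegers p) ^ (c - 1)) * L₀, ?_⟩
    rw [hLL₀, ← mul_assoc, ← map_mul, ← pow_succ', Nat.sub_add_cancel hc]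

section Frames

variable {K : Type} [Field K] [NumberField K] {p : ℕ} [Fact p.Prime] {N : ℕ}
  {ι : PadicAlgCl p ≃+* ℂ} {𝔭 : HeightOneSpectrum (𝓞 K)} {κ : ZpExtension K p}
  {γ : absoluteGaloisGroup K} {f : CuspForm (CongruenceSubgroup.Gamma0 N) 2} {χ : HeckeCharacter K}
  {e : ℂ} {ΩK : ℂ} {Ωp : ℂ_[p]}

/-- **Dividing a branch frame by a constant**: if `L = a · L₀` in `R₀⟦T⟧` is a branch frame with
constant `e`, and `a ∈ R₀` is the image of a non-zero complex number `a′` under `ι⁻¹ : ℂ → ℚ̄_p ⊂ ℂ_p`,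
then `L₀` is a branch frame with constant `e/a′` and the same periods (the prescribed values are
linear in `e`, `bdpBranchInterpolationValue_smul`). Used with `a = p^c`.
[cite: CastellaHsieh2018, §3.3 (the multiplier e_𝔭 enters the interpolation value linearly)] -/
theorem isBranchBDPLFunction_of_eq_C_mul {a : unrIntegers p} {a' : ℂ} (ha' : a' ≠ 0)
    (ha : (a : ℂ_[p]) = ((ι.symm a' : PadicAlgCl p) : ℂ_[p])) {L L₀ : UnrSeries p}
    (hLL₀ : L = C a * L₀) (hL : IsBranchBDPLFunction ι 𝔭 κ γ f χ e ΩK Ωp L) :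
    IsBranchBDPLFunction ι 𝔭 κ γ f χ (a'⁻¹ * e) ΩK Ωp L₀ := by
  intro φ n hn hunr hinf r hr hκr
  have hv := hL φ n hn hunr hinf r hr hκr
  have ha0 : (a : ℂ_[p]) ≠ 0 := by
    rw [ha, PadicComplex.coe_eq]
    exact (map_ne_zero _).mpr ((map_ne_zero ι.symm).mpr ha')
  -- the coefficients of `L = a · L₀` are `a · [T^k]L₀`
  have hcoeff : ∀ k : ℕ, ((PowerSeries.coeff k L : unrIntegers p) : ℂ_[p]) =
      (a : ℂ_[p]) * ((PowerSeries.coeff k L₀ : unrIntegers p) : ℂ_[p]) := fun k ↦ by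
    rw [hLL₀, PowerSeries.coeff_C_mul, Subring.coe_mul]
  unfold UnrSeries.HasValueAt at hv ⊢
  simp_rw [hcoeff, mul_assoc] at hv
  have hv' := hv.mul_left ((a : ℂ_[p])⁻¹)
  simp_rw [← mul_assoc, inv_mul_cancel₀ ha0, one_mul] at hv'
  have heq : ((ι.symm (bdpBranchInterpolationValue f 𝔭 χ (a'⁻¹ * e) φ n ΩK) : PadicAlgCl p) :
        ℂ_[p]) * Ωp ^ (4 * n) =
      (a : ℂ_[p])⁻¹ * ((ι.symm (bdpBranchInterpolationValue f 𝔭 χ e φ n ΩK) : PadicAlgCl p) :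
        ℂ_[p]) * Ωp ^ (4 * n) := by
    rw [bdpBranchInterpolationValue_smul, map_mul, map_inv₀, ha]
    simp only [PadicComplex.coe_eq, map_mul, map_inv₀]
  rw [heq]
  exact hv'

end Frames

/-- **A `μ = 0` frame with the equality, from ANY branch frame** (KY′ (iii) self-improves): given
`thm351_charIdeal_eq_branch_OPEN` and a branch frame `(e ≠ 0, Ω_K ≠ 0, Ω_p ≠ 0, L)` of `(f′, χ_ε)` at
`v`, the quotient `L₀ = L/p^c` is again a branch frame — with constant `e/p^c ≠ 0` and the SAME periods
(`isBranchBDPLFunction_of_eq_C_mul`) — and it has `μ(L₀) = 0`, `λ(L₀) = λ(𝔛)` and `Char_Λ(𝔛)·R₀⟦T⟧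
= (L₀)`. Hence a consumer of the door direction needs neither `thm351_mu_zero_branch_OPEN` nor Tate's
local constant. CONDITIONAL on the OPEN claim; bookkeeping. [claim: KellerYin2024PotOrd, status: under-review] -/
theorem exists_frame_firstUnitCoeff_charIdeal_eq_of_branch_OPEN (h : thm351_charIdeal_eq_branch_OPEN)
    {p : ℕ} [Fact p.Prime] (ι' : PadicAlgCl p ≃+* ℂ) (W : WeierstrassCurve ℚ) [W.IsElliptic]
    [W.IsGloballyMinimal] (K : Type) [Field K] [NumberField K] [IsGalois ℚ K]
    (v vbar : HeightOneSpectrum (𝓞 K)) (κ : ZpExtension K p) (γ : absoluteGaloisGroup K)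
    [Fact (κ.IsTopGenerator γ)] {N : ℕ} [NeZero N] {f : CuspForm (CongruenceSubgroup.Gamma0 N) 2}
    (hf : IsNewformOf W f) (hS : PotOrdSetting ι' W K v vbar κ N)
    {N' : ℕ} [NeZero N'] {f' : CuspForm (CongruenceSubgroup.Gamma0 N') 2} (hf' : IsNewform0 f')
    (hpN' : ¬ p ∣ N')
    (htw : ∃ S : Finset ℕ, ∀ ℓ : ℕ, ℓ.Prime → ℓ ∉ S →
      cuspCoeff f ℓ = ((legendreSym p ℓ : ℤ) : ℂ) * cuspCoeff f' ℓ)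
    {e : ℂ} {ΩK : ℂ} {Ωp : ℂ_[p]} {L : UnrSeries p} (he : e ≠ 0) (hΩK : ΩK ≠ 0) (hΩp : Ωp ≠ 0)
    (hL : IsBranchBDPLFunction ι' v κ γ f' (genusHeckeCharacter K p) e ΩK Ωp L)
    (j : ℤ_[p] →+* unrIntegers p)
    (hj : ∀ x : ℤ_[p], ((j x : unrIntegers p) : ℂ_[p]) = algebraMap ℚ_[p] ℂ_[p] (x : ℚ_[p])) :
    ∃ (e₀ : ℂ) (L₀ : UnrSeries p), e₀ ≠ 0 ∧
      IsBranchBDPLFunction ι' v κ γ f' (genusHeckeCharacter K p) e₀ ΩK Ωp L₀ ∧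
      FirstUnitCoeffAt L₀ (lambdaInvariant p (AcSelmer.XAc (W.baseChange K) p κ vbar ∅ γ)) ∧
      (AcSelmer.XAc.charIdeal (W.baseChange K) p κ vbar ∅ γ).map (PowerSeries.map j) =
        Ideal.span {L₀} := by
  obtain ⟨c, L₀, hLL₀, hfu, hspan⟩ :=
    h ι' W K v vbar κ γ hf hS hf' hpN' htw e ΩK Ωp L he hΩK hΩp hL j hj
  have hpc : ((p : ℂ) ^ c) ≠ 0 := pow_ne_zero _ (Nat.cast_ne_zero.mpr (Fact.out : p.Prime).ne_zero)
  refine ⟨((p : ℂ) ^ c)⁻¹ * e, L₀, mul_ne_zero (inv_ne_zero hpc) he, ?_, hfu, hspan⟩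
  refine isBranchBDPLFunction_of_eq_C_mul hpc ?_ hLL₀ hL
  rw [map_pow, map_natCast, Subring.coe_pow, Subring.coe_natCast, PadicComplex.coe_eq, map_pow,
    map_natCast]

/-- **The package for the door (H1 ∧ H3 at the frame, by name): a `μ = 0` branch frame at `v` with
`Char_Λ(𝔛)·R₀⟦T⟧ = (L₀)` EXISTS**, from the Castella–Hsieh existence fact (PUBLISHED, Math. Ann. 2018
Def. 3.7 + Prop. 3.8: `castellaHsieh2018_exists_isBranchBDPLFunction`) and Keller–Yin Thm. 3.5.1 in
branch currency (PREPRINT, `thm351_charIdeal_eq_branch_OPEN`). Hypotheses: the Keller–Yin standing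
data `PotOrdSetting ι' W K v v̄ κ N` with `IsNewformOf W f` and `p ∈ v`; the partner presented by an elliptic
curve `W′` with newform `f′` of level `N′` (`IsNewformOf W′ f′` — Castella–Hsieh's measure needs
rational coefficients), `p ∤ N′`, the Heegner hypothesis for `N′` (on the door `N′ ∣ N = N′p²`), the
twist relation; and the three branch-character facts about `χ_ε` — two PROVED above, the conductor
exponent `1` above `p` carried as the hypothesis `hcond` (local class field theory for `ψ_ε`, to be
discharged separately). CONDITIONAL on one published fact and one preprint claim; nothing asserted.
[claim: KellerYin2024PotOrd, status: under-review]
[cite: CastellaHsieh2018, Def. 3.7 and Prop. 3.8 (existence of the branch frame)] -/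
theorem exists_frame_charIdeal_eq_of_castellaHsieh_of_branch_OPEN
    (hCH : castellaHsieh2018_exists_isBranchBDPLFunction) (h : thm351_charIdeal_eq_branch_OPEN)
    {p : ℕ} [Fact p.Prime] (ι' : PadicAlgCl p ≃+* ℂ) (W : WeierstrassCurve ℚ) [W.IsElliptic]
    [W.IsGloballyMinimal] (K : Type) [Field K] [NumberField K] [IsGalois ℚ K]
    (v vbar : HeightOneSpectrum (𝓞 K)) (κ : ZpExtension K p) (γ : absoluteGaloisGroup K)
    [hγ : Fact (κ.IsTopGenerator γ)] {N : ℕ} [NeZero N]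
    {f : CuspForm (CongruenceSubgroup.Gamma0 N) 2} (hf : IsNewformOf W f)
    (hS : PotOrdSetting ι' W K v vbar κ N) (hv : ((p : ℕ) : 𝓞 K) ∈ v.asIdeal)
    (W' : WeierstrassCurve ℚ) [W'.IsElliptic] {N' : ℕ} [NeZero N']
    {f' : CuspForm (CongruenceSubgroup.Gamma0 N') 2} (hf' : IsNewformOf W' f') (hpN' : ¬ p ∣ N')
    (hHe' : SatisfiesHeegnerHypothesis N' K)
    (htw : ∃ S : Finset ℕ, ∀ ℓ : ℕ, ℓ.Prime → ℓ ∉ S →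
      cuspCoeff f ℓ = ((legendreSym p ℓ : ℤ) : ℂ) * cuspCoeff f' ℓ)
    (hcond : ∀ 𝔮 : HeightOneSpectrum (𝓞 K), ((p : ℕ) : 𝓞 K) ∈ 𝔮.asIdeal →
      (genusHeckeCharacter K p).HasConductorExponentAt 𝔮 1)
    (j : ℤ_[p] →+* unrIntegers p)
    (hj : ∀ x : ℤ_[p], ((j x : unrIntegers p) : ℂ_[p]) = algebraMap ℚ_[p] ℂ_[p] (x : ℚ_[p])) :
    ∃ (e₀ : ℂ) (ΩK : ℂ) (Ωp : (unrIntegers p)ˣ) (L₀ : UnrSeries p), e₀ ≠ 0 ∧ ΩK ≠ 0 ∧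
      IsBranchBDPLFunction ι' v κ γ f' (genusHeckeCharacter K p) e₀ ΩK
        ((Ωp : unrIntegers p) : ℂ_[p]) L₀ ∧
      FirstUnitCoeffAt L₀ (lambdaInvariant p (AcSelmer.XAc (W.baseChange K) p κ vbar ∅ γ)) ∧
      (AcSelmer.XAc.charIdeal (W.baseChange K) p κ vbar ∅ γ).map (PowerSeries.map j) =
        Ideal.span {L₀} := by
  have hp2 : p ≠ 2 := fun h2 ↦ by have := hS.two_lt; omega
  obtain ⟨e, ΩK, Ωp, L, he, hΩK, hL⟩ := hCH ι' W' K v κ γ hf' (genusHeckeCharacter K p) hp2 hpN'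
    hS.imagQuad hS.split hv hS.induces hHe' hS.anticyclotomic hγ.out (genusHeckeCharacter_sq K p)
    (fun w hw ↦ genusHeckeCharacter_isUnramifiedAt K p hw) hcond
  have hΩp : ((Ωp : unrIntegers p) : ℂ_[p]) ≠ 0 := by
    rw [Ne, ZeroMemClass.coe_eq_zero]
    exact Ωp.ne_zero
  obtain ⟨e₀, L₀, he₀, hL₀, hfu, hspan⟩ :=
    exists_frame_firstUnitCoeff_charIdeal_eq_of_branch_OPEN h ι' W K v vbar κ γ hf hS hf'.1 hpN' htw
      he hΩK hΩp hL j hj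
  exact ⟨e₀, ΩK, Ωp, L₀, he₀, hΩK, hL₀, hfu, hspan⟩

end Literature.NumberTheory.EllipticCurves.KellerYin2024

end
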